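import Summits.HubbardSuperconductivity.HubbardLadder.Bounds.ConnectedBondSetEntropy
import HarnessLib

/-!
/-!
# One-site Kotecký–Preiss smallness of coupling-function polymer activities:
# the Catalan entropy recursion × Cauchy estimates with one radius per bond

HONEST FRAMING (cell pub-hubbard): ladder R1–R4 with certified numbers; no claim on H/H₀. This file
proves bounds for model classes (coupling-function polymer activities of Hubbard-type lattice
fermions), no materials claim. LEAN FILING REQUEST #195 part 3 of 5 (bounds g25); generic — it imports only
the tree (`Literature.MathematicalPhysics.QuantumLattice.HubbardCouplingWeights`) and parts 1–2
(`ConnectedBondSetDecomposition`, `ConnectedBondSetEntropy`), and is used by parts 4–5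
(`TwistedCouplingDegree`, `TwistInsensitivityCatalan`) on the seam-twisted `t–t'` torus.

## What is proved (0 sorry)

Setting: a finite set `D` of directed spin-bonds `b = (x, y, σ)` (`Bond Λ`, vertex sets
`verts b = {x, y}`), complex bond couplings `c_b`, complex `β, U, μ` with `z₀ = atomicPartitionFn ≠ 0`,
and the tree's coupling-function activities `couplingActivity D β U μ c A = Σ_{X ⊆ D connected,
supp X = A} M_c(X)`, `M_c(X) = couplingWeight β U μ c X` (iterated differences of
`S ↦ Tr e^{-βH_S}/z₀^{|supp|}` over the bonds, `HubbardCouplingWeights`).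

1. ENTROPY (`sum_prod_mul_exp_card_cellSupp_le`, part 2 `ConnectedBondSetEntropy`). For bond weights `w_b ≥ 0`, a site weight `e^{a}`
   (`a ≥ 0`) and a bound `W` on the weighted degree `Σ_{b ∈ D, v ∈ verts b} w_b ≤ W` of every site:

     if `e^{a} + W F² ≤ F` then `Σ_{X ⊆ D connected, v ∈ supp X} (∏_{b ∈ X} w_b) e^{a |supp X|} ≤ F - e^{a}`.

   The smallest admissible `F` is `e^{a} c(W e^{a})`, `c(s) = (1 - √(1-4s))/(2s)` the Catalan
   generating function — the tree-graph entropy lemma of the high-temperature Kotecký–Preiss argument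
   (paper `bounds.tex` §12, Lemma 12.4) WITHOUT spanning-tree / plane-tree counting: the proof is a
   direct recursion on the number of bonds. Removing a chosen bond `b₀ ∋ v` from a connected `X` leaves
   the component `X₁` through `v` and the component `X₂` through the other endpoint `u` of `b₀` (empty,
   or equal to `X₁`, allowed), `X = {b₀} ⊔ X₁ ⊔ X₂`, `|supp X| ≤ |{v} ∪ supp X₁| + |{u} ∪ supp X₂|`; so
   with `Θ_N(v) = e^{a} + Σ_{|X| ≤ N} …`: `Θ_{N+1}(v) ≤ e^{a} + W Θ_N(v) Θ_N(u) ≤ e^{a} + W F² ≤ F` by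
   induction on `N`.
2. ENERGY (`norm_couplingWeight_le_prod`). If `|c_b| ≤ δ_b` on `K` then
   `|M_c(K)| ≤ ∏_{b ∈ K} (δ_b e^{1+δ_b}) · r^{|supp K|}`, `r = siteRatio` — Cauchy's estimate for the
   iterated difference with radius `1/δ_b` in the coordinate `b` (`norm_iterDiff_zero_le_prod`, a
   per-coordinate-radius version of the tree's `IteratedDifferenceBound`), and the a-priori bound
   `|Tr e^{-βH_S(c')}| ≤ e^{Σ|c'_b|} …` of `HubbardPolymerBounds`.
3. SMALLNESS (`sum_norm_couplingActivity_mul_exp_le_catalan`, `…_le_one`). With `r ≤ 1` (real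
   parameters), `W ≥ sup_v Σ_{b ∋ v} δ_b e^{1+δ_b}` and `e^{a} + W F² ≤ F`:
   `Σ_{A ∋ x} |couplingActivity D c A| e^{a|A|} ≤ F - e^{a}`; in particular (`a = 1+δ'`,
   `F = e^{1+δ'}+1`) the one-site Kotecký–Preiss hypothesis `Σ_{A ∋ x} |ρ_c(A)| e^{(1+δ')|A|} ≤ 1`
   as soon as `W (e^{1+δ'}+1)² ≤ 1`.

Compared with the tree's `sum_norm_couplingActivity_mul_exp_le` (lattice-animal count
`(2m+1)^{2|X|}`, one global coupling size) the gain is the factor `e·(max degree)` → `W` per bond; on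
the `t–t'` torus this moves the certified window from `T ≥ 6.8·10⁶(|t|+|t'|)` (#181.6) to
`T ≥ 610(|t|+|t'|)` (#195 part 5). The paper's `160` needs Hölder bond weights `e^{|c_b|}-1` in step 2
(not done here; see part 5's header).

## Mathlib / tree search

Tree: `rcomponent`, `isRConnected_rcomponent`, `rcomponent_eq_of_mem` (`PolymerGasGeometric`),
`cellSupp`, `ShareVertex`, `connectedCellSets` (`PolymerPushforward`), `Bond.verts`
(`HubbardBondAlgebra`), `iterDiff`, `fwdDiff` (`FiniteDifference`), `norm_iterDiff_le`
(`IteratedDifferenceBound`, one radius for all coordinates), `couplingWeight_eq_zero_of_apply_eq_zero`,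
`differentiable_gibbsRatio_mul`, `norm_gibbsRatio_le` (`HubbardCouplingWeights`, `HubbardPolymerBounds`).
Mathlib: `Complex.norm_deriv_le_of_forall_mem_sphere_norm_le` (Cauchy estimate), `Finset.sum_sigma`,
`Finset.sum_image`. No tree lemma counts connected cell sets by a tree recursion (`LatticeAnimals*`
count by cardinality only).

## References

* R. Kotecký, D. Preiss, Comm. Math. Phys. 103 (1986) 491, Theorem p. 492 (condition (1)). [KoteckyPreiss1986]
* D. Ueltschi, J. Stat. Phys. 95 (1999) 693 (arXiv:cond-mat/9810320), §2.3, §3. [Ueltschi1999]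
-/
-/

noncomputable section

namespace Summit.HubbardSuperconductivity.HubbardLadder.Bounds

open Finset Literature.Probability.LatticeModels Literature.MathematicalPhysics.QuantumLattice

/-! ### Cauchy bounds for iterated differences with per-coordinate radii -/

section Cauchy

open Literature.Analysis.Complex.FiniteDifference Metric

variable {K : Type*} [DecidableEq K]

/-- The polydisc with a radius per coordinate: the `c'` within `ρ_k` of `c` in the coordinates
`k ∈ S` that agree with `c` elsewhere. [folklore] -/
def polydiscR (S : Finset K) (c : K → ℂ) (ρ : K → ℝ) : Set (K → ℂ) :=
  {c' | (∀ k ∈ S, ‖c' k - c k‖ ≤ ρ k) ∧ ∀ k ∉ S, c' k = c k}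

omit [DecidableEq K] in
/-- Membership in the polydisc `polydiscR`, unfolded. [this file] -/
theorem mem_polydiscR {S : Finset K} {c : K → ℂ} {ρ : K → ℝ} {c' : K → ℂ} :
    c' ∈ polydiscR S c ρ ↔ (∀ k ∈ S, ‖c' k - c k‖ ≤ ρ k) ∧ ∀ k ∉ S, c' k = c k := Iff.rfl

omit [DecidableEq K] in
/-- The centre belongs to its polydisc. [this file] -/
theorem self_mem_polydiscR {S : Finset K} {c : K → ℂ} {ρ : K → ℝ} (hρ : ∀ k ∈ S, 0 ≤ ρ k) :
    c ∈ polydiscR S c ρ :=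
  mem_polydiscR.2 ⟨fun k hk => by simp [hρ k hk], fun _ _ => rfl⟩

/-- A one-coordinate perturbation of radius `≤ R` stays in the polydisc. [this file] -/
theorem add_single_mem_polydiscR {S : Finset K} {c c' : K → ℂ} {ρ : K → ℝ} {k : K}
    (hk : k ∉ S) (hc' : c' ∈ polydiscR S c ρ) {z : ℂ} (hz : ‖z‖ ≤ ρ k) :
    c' + z • (Pi.single k 1 : K → ℂ) ∈ polydiscR (insert k S) c ρ := by
  rw [mem_polydiscR] at hc' ⊢
  refine ⟨fun k' hk' => ?_, fun k' hk' => ?_⟩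
  · rcases Finset.mem_insert.1 hk' with rfl | hk'S
    · have h0 : c' k' = c k' := hc'.2 k' hk
      simp [h0, hz]
    · have hne : k' ≠ k := fun h => hk (h ▸ hk'S)
      simp [Pi.single_eq_of_ne hne, hc'.1 k' hk'S]
  · have hne : k' ≠ k := fun h => hk' (h ▸ Finset.mem_insert_self k S)
    have hk'S : k' ∉ S := fun h => hk' (Finset.mem_insert_of_mem h)
    simp [Pi.single_eq_of_ne hne, hc'.2 k' hk'S]

variable [Fintype K]

/-- One-variable step with radius `R_k` in the coordinate `k`. [folklore; Hörmander Thm 2.2.7 style] -/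
theorem norm_fwdDiff_le_of_mem_polydiscR {S : Finset K} {k : K} (hk : k ∉ S) {g : (K → ℂ) → ℂ}
    (hg : Differentiable ℂ g) {c : K → ℂ} {τ : ℂ} {R : K → ℝ} {B : ℝ} (hR : 0 < R k)
    (hB : ∀ c' ∈ polydiscR (insert k S) c (fun k => ‖τ‖ + R k), ‖g c'‖ ≤ B)
    {c' : K → ℂ} (hc' : c' ∈ polydiscR S c (fun k => ‖τ‖ + R k)) :
    ‖fwdDiff (τ • (Pi.single k 1 : K → ℂ)) g c'‖ ≤ ‖τ‖ / R k * B := by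
  set φ : ℂ → ℂ := fun ζ => g (c' + ζ • (Pi.single k 1 : K → ℂ)) with hφ
  have hφd : Differentiable ℂ φ := by
    rw [hφ]
    fun_prop
  have hderiv : ∀ ζ ∈ closedBall (0 : ℂ) ‖τ‖, ‖deriv φ ζ‖ ≤ B / R k := by
    intro ζ hζ
    refine Complex.norm_deriv_le_of_forall_mem_sphere_norm_le hR hφd.diffContOnCl fun z hz => ?_
    refine hB _ ?_
    have hz' : ‖z‖ ≤ ‖τ‖ + R k := by
      have h1 : ‖z - ζ‖ = R k := by rwa [mem_sphere_iff_norm] at hz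
      have h2 : ‖ζ‖ ≤ ‖τ‖ := by rwa [mem_closedBall, dist_zero_right] at hζ
      calc ‖z‖ = ‖(z - ζ) + ζ‖ := by rw [sub_add_cancel]
        _ ≤ ‖z - ζ‖ + ‖ζ‖ := norm_add_le _ _
        _ ≤ R k + ‖τ‖ := add_le_add h1.le h2
        _ = ‖τ‖ + R k := add_comm _ _
    exact add_single_mem_polydiscR hk hc' hz'
  have hmvt := (convex_closedBall (0 : ℂ) ‖τ‖).norm_image_sub_le_of_norm_deriv_le
    (fun ζ _ => hφd.differentiableAt) hderiv (mem_closedBall_self (norm_nonneg τ))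
    (by rw [mem_closedBall, dist_zero_right])
  have h0 : φ 0 = g c' := by simp [hφ]
  have hτ : φ τ = g (c' + τ • (Pi.single k 1 : K → ℂ)) := rfl
  rw [fwdDiff, ← hτ, ← h0]
  calc ‖φ τ - φ 0‖ ≤ B / R k * ‖τ - 0‖ := hmvt
    _ = ‖τ‖ / R k * B := by rw [sub_zero]; ring

/-- **Cauchy bound with per-coordinate radii**: `|Δ^τ_S g(c)| ≤ (∏_{k∈S} |τ|/R_k) · sup_{polydisc} |g|`.
[folklore; Hörmander Thm 2.2.7 style] -/
theorem norm_iterDiff_le_prod {g : (K → ℂ) → ℂ} (hg : Differentiable ℂ g) {τ : ℂ} {R : K → ℝ}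
    (S : Finset K) (hR : ∀ k ∈ S, 0 < R k) {c : K → ℂ} {B : ℝ}
    (hB : ∀ c' ∈ polydiscR S c (fun k => ‖τ‖ + R k), ‖g c'‖ ≤ B) :
    ‖iterDiff τ S g c‖ ≤ (∏ k ∈ S, ‖τ‖ / R k) * B := by
  induction S using Finset.induction_on generalizing g B with
  | empty =>
    rw [iterDiff_empty, Finset.prod_empty, one_mul]
    exact hB c (self_mem_polydiscR fun k hk => (Finset.notMem_empty k hk).elim)
  | @insert k S hk ih =>
    rw [iterDiff_insert τ hk, Finset.prod_insert hk, mul_assoc]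
    have hd : Differentiable ℂ (fwdDiff (τ • (Pi.single k 1 : K → ℂ)) g) := by
      unfold fwdDiff; fun_prop
    have hRk : 0 < R k := hR k (Finset.mem_insert_self k S)
    have h := ih hd (fun k' hk' => hR k' (Finset.mem_insert_of_mem hk'))
      (fun c' hc' => norm_fwdDiff_le_of_mem_polydiscR hk hg hRk hB hc')
    calc ‖iterDiff τ S (fwdDiff (τ • (Pi.single k 1 : K → ℂ)) g) c‖ ≤ (∏ k ∈ S, ‖τ‖ / R k) * (‖τ‖ / R k * B) := h
      _ = ‖τ‖ / R k * ((∏ k ∈ S, ‖τ‖ / R k) * B) := by ring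

/-- Base point `0`, bound on vectors supported in `S` with `|c'_k| ≤ |τ| + R_k` (`k ∈ S`). [folklore] -/
theorem norm_iterDiff_zero_le_prod {g : (K → ℂ) → ℂ} (hg : Differentiable ℂ g) {τ : ℂ} {R : K → ℝ}
    (S : Finset K) (hR : ∀ k ∈ S, 0 < R k) {B : ℝ}
    (hB : ∀ c' : K → ℂ, (∀ k ∈ S, ‖c' k‖ ≤ ‖τ‖ + R k) → (∀ k ∉ S, c' k = 0) → ‖g c'‖ ≤ B) :
    ‖iterDiff τ S g 0‖ ≤ (∏ k ∈ S, ‖τ‖ / R k) * B := by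
  refine norm_iterDiff_le_prod hg S hR fun c' hc' => hB c' (fun k hk => ?_) (mem_polydiscR.1 hc').2
  simpa using (mem_polydiscR.1 hc').1 k hk

end Cauchy

/-! ### Smallness per bond with bond-dependent sizes -/

section Weights

open Literature.Analysis.Complex.FiniteDifference

variable {Λ : Type*} [LinearOrder Λ] [Fintype Λ] {β U μ : ℂ}

/-- **Smallness per bond, bond by bond**: if `|c_b| ≤ δ_b` (`δ_b ≥ 0`) on `K` then
`|couplingWeight c K| ≤ ∏_{b∈K} (δ_b e^{1+δ_b}) · r^{|supp K|}` (`r = siteRatio`; Cauchy's estimate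
with radius `1/δ_b` in the coordinate `b`). [folklore; cf. Ueltschi1999 §2.3] -/
theorem norm_couplingWeight_le_prod (hz : atomicPartitionFn β U μ ≠ 0) {δ : Bond Λ → ℝ}
    {c : Bond Λ → ℂ} {K : Finset (Bond Λ)} (hδ : ∀ b ∈ K, 0 ≤ δ b) (hc : ∀ b ∈ K, ‖c b‖ ≤ δ b) :
    ‖couplingWeight β U μ c K‖ ≤
      (∏ b ∈ K, δ b * Real.exp (1 + δ b)) * siteRatio β U μ ^ (cellSupp Bond.verts K).card := by
  by_cases h0 : ∃ b ∈ K, δ b = 0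
  · obtain ⟨b, hb, hb0⟩ := h0
    have hcb : c b = 0 := norm_le_zero_iff.1 (hb0 ▸ hc b hb)
    rw [couplingWeight_eq_zero_of_apply_eq_zero hb hcb, norm_zero]
    exact mul_nonneg (Finset.prod_nonneg fun b hb => mul_nonneg (hδ b hb) (Real.exp_nonneg _))
      (pow_nonneg (siteRatio_nonneg _ _ _) _)
  · push Not at h0
    have hδpos : ∀ b ∈ K, 0 < δ b := fun b hb => lt_of_le_of_ne (hδ b hb) (fun h => h0 b hb h.symm)
    have hR : ∀ b ∈ K, (0 : ℝ) < 1 / δ b := fun b hb => by have := hδpos b hb; positivity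
    have hB : ∀ z : Bond Λ → ℂ, (∀ b ∈ K, ‖z b‖ ≤ ‖(1 : ℂ)‖ + 1 / δ b) → (∀ b ∉ K, z b = 0) →
        ‖gibbsRatio β U μ (c * z)‖ ≤
          Real.exp (∑ b ∈ K, (δ b + 1)) * siteRatio β U μ ^ (cellSupp Bond.verts K).card := by
      intro z hz' hK
      have hK' : ∀ b ∉ K, (c * z) b = 0 := fun b hb => by rw [Pi.mul_apply, hK b hb, mul_zero]
      have hsupp : ∀ b, (c * z) b ≠ 0 → b.1 ∈ cellSupp Bond.verts K ∧ b.2.1 ∈ cellSupp Bond.verts K := by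
        intro b hb
        have hbK : b ∈ K := by by_contra h; exact hb (hK' b h)
        exact endpoints_mem_cellSupp hbK
      refine (norm_gibbsRatio_le hz hsupp).trans
        (mul_le_mul_of_nonneg_right ?_ (pow_nonneg (siteRatio_nonneg _ _ _) _))
      rw [Real.exp_le_exp]
      refine (norm_hopSum_le _).trans ?_
      rw [← Finset.sum_subset (Finset.subset_univ K) (fun b _ hb => by rw [hK' b hb, norm_zero])]
      refine Finset.sum_le_sum fun b hb => ?_
      rw [Pi.mul_apply, norm_mul]
      have hδb := hδpos b hb
      calc ‖c b‖ * ‖z b‖ ≤ δ b * (‖(1 : ℂ)‖ + 1 / δ b) :=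
            mul_le_mul (hc b hb) (hz' b hb) (norm_nonneg _) (hδ b hb)
        _ = δ b + 1 := by rw [norm_one]; field_simp
    have h := norm_iterDiff_zero_le_prod (differentiable_gibbsRatio_mul β U μ c) K hR hB
    rw [couplingWeight]
    refine h.trans (le_of_eq ?_)
    rw [norm_one, Real.exp_sum, ← mul_assoc, ← Finset.prod_mul_distrib]
    congr 1
    refine Finset.prod_congr rfl fun b hb => ?_
    rw [one_div_one_div, add_comm]

end Weights

/-! ### One-site Kotecký–Preiss smallness with the Catalan entropy bound -/

section Smallness

variable {Λ : Type*} [LinearOrder Λ] [Fintype Λ] {β U μ : ℂ} {D : Finset (Bond Λ)}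

/-- **THEOREM (one-site KP smallness of coupling-function activities, Catalan form).** If
`z₀(β,U,μ) ≠ 0`, `r = siteRatio ≤ 1` (e.g. real parameters), `|c_b| ≤ δ_b` with `δ_b ≥ 0` on `D`, the
weighted degree `Σ_{b ∈ D, v ∈ b} δ_b e^{1+δ_b} ≤ W` at every site, `a ≥ 0` and `e^{a} + W F² ≤ F`,
then for every site `x` and finite family `𝒜` of site sets through `x`:
`Σ_{A ∈ 𝒜} |couplingActivity D c A| e^{a|A|} ≤ F - e^{a}`.
[folklore: KoteckyPreiss1986 condition (1) via the tree-graph bound; cf. Ueltschi1999 §3] -/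
theorem sum_norm_couplingActivity_mul_exp_le_catalan (hz : atomicPartitionFn β U μ ≠ 0)
    (hr : siteRatio β U μ ≤ 1) {δ : Bond Λ → ℝ} (hδ : ∀ b ∈ D, 0 ≤ δ b) {c : Bond Λ → ℂ}
    (hc : ∀ b ∈ D, ‖c b‖ ≤ δ b) {a W F : ℝ} (ha : 0 ≤ a)
    (hW : ∀ v : Λ, ∑ b ∈ D.filter (fun b => v ∈ Bond.verts b), δ b * Real.exp (1 + δ b) ≤ W)
    (hF : Real.exp a + W * F ^ 2 ≤ F) (x : Λ) (𝒜 : Finset (Finset Λ)) (h𝒜 : ∀ A ∈ 𝒜, x ∈ A) :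
    ∑ A ∈ 𝒜, ‖couplingActivity D β U μ c A‖ * Real.exp (a * A.card) ≤ F - Real.exp a := by
  classical
  set CC := connectedCellSets Bond.verts D with hCC
  set f : Finset (Bond Λ) → ℝ := fun X =>
    ‖couplingWeight β U μ c X‖ * Real.exp (a * ((cellSupp Bond.verts X).card : ℝ)) with hf
  have hf0 : ∀ X, 0 ≤ f X := fun X => by positivity
  set Sx := CC.filter fun X => x ∈ cellSupp Bond.verts X with hSx
  -- Step a: bound by a sum over connected bond sets through `x`
  have stepA : ∑ A ∈ 𝒜, ‖couplingActivity D β U μ c A‖ * Real.exp (a * A.card) ≤ ∑ X ∈ Sx, f X := by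
    have h1 : ∀ A ∈ 𝒜, ‖couplingActivity D β U μ c A‖ * Real.exp (a * A.card) ≤
        ∑ X ∈ CC.filter (fun X => cellSupp Bond.verts X = A), f X := by
      intro A _
      rw [couplingActivity_apply, ← hCC]
      refine (mul_le_mul_of_nonneg_right (norm_sum_le _ _) (Real.exp_nonneg _)).trans ?_
      rw [Finset.sum_mul]
      refine Finset.sum_le_sum fun X hX => le_of_eq ?_
      simp only [hf]
      rw [(Finset.mem_filter.1 hX).2]
    refine (Finset.sum_le_sum h1).trans ?_
    rw [← Finset.sum_biUnion]
    · refine Finset.sum_le_sum_of_subset_of_nonneg ?_ fun X _ _ => hf0 X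
      intro X hX
      obtain ⟨A, hA, hXA⟩ := Finset.mem_biUnion.1 hX
      obtain ⟨hXCC, hXsupp⟩ := Finset.mem_filter.1 hXA
      exact Finset.mem_filter.2 ⟨hXCC, hXsupp ▸ h𝒜 A hA⟩
    · intro A hA B hB hAB
      refine Finset.disjoint_left.2 fun X hXA hXB => hAB ?_
      rw [← (Finset.mem_filter.1 hXA).2, ← (Finset.mem_filter.1 hXB).2]
  -- Step b: each term is at most the tree-graph weight
  set w : Bond Λ → ℝ := fun b => δ b * Real.exp (1 + δ b) with hw
  have hw0 : ∀ b ∈ D, 0 ≤ w b := fun b hb => mul_nonneg (hδ b hb) (Real.exp_nonneg _)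
  have stepB : ∀ X ∈ Sx, f X ≤ (∏ b ∈ X, w b) * Real.exp (a * ((cellSupp Bond.verts X).card : ℝ)) := by
    intro X hX
    have hXD : X ⊆ D := (mem_connectedCellSets.1 (Finset.mem_filter.1 hX).1).1
    have hb := norm_couplingWeight_le_prod hz (K := X) (fun b hb => hδ b (hXD hb)) fun b hb => hc b (hXD hb)
    refine mul_le_mul_of_nonneg_right (hb.trans ?_) (Real.exp_nonneg _)
    have hp : 0 ≤ ∏ b ∈ X, w b := Finset.prod_nonneg fun b hb => hw0 b (hXD hb)
    calc (∏ b ∈ X, δ b * Real.exp (1 + δ b)) * siteRatio β U μ ^ (cellSupp Bond.verts X).card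
        ≤ (∏ b ∈ X, w b) * 1 :=
          mul_le_mul_of_nonneg_left (pow_le_one₀ (siteRatio_nonneg _ _ _) hr) hp
      _ = ∏ b ∈ X, w b := mul_one _
  -- Step c: the Catalan entropy bound
  calc ∑ A ∈ 𝒜, ‖couplingActivity D β U μ c A‖ * Real.exp (a * A.card)
      ≤ ∑ X ∈ Sx, f X := stepA
    _ ≤ ∑ X ∈ Sx, (∏ b ∈ X, w b) * Real.exp (a * ((cellSupp Bond.verts X).card : ℝ)) := Finset.sum_le_sum stepB
    _ ≤ F - Real.exp a := sum_prod_mul_exp_card_cellSupp_le hw0 ha hW hF x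

/-- **COROLLARY (the one-site Kotecký–Preiss form with rate `δ'`).** Under the hypotheses of
`sum_norm_couplingActivity_mul_exp_le_catalan` with `W (e^{1+δ'} + 1)² ≤ 1`:
`Σ_{A ∋ x} |couplingActivity D c A| e^{(1+δ')|A|} ≤ 1` — hypothesis (1) of [KP86] with `a = |·|`,
`d = δ'|·|`. [cite: KoteckyPreiss1986, Theorem p. 492, hypothesis (1)] -/
theorem sum_norm_couplingActivity_mul_exp_le_one (hz : atomicPartitionFn β U μ ≠ 0)
    (hr : siteRatio β U μ ≤ 1) {δ : Bond Λ → ℝ} (hδ : ∀ b ∈ D, 0 ≤ δ b) {c : Bond Λ → ℂ}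
    (hc : ∀ b ∈ D, ‖c b‖ ≤ δ b) {W δ' : ℝ} (hδ' : 0 ≤ δ')
    (hW : ∀ v : Λ, ∑ b ∈ D.filter (fun b => v ∈ Bond.verts b), δ b * Real.exp (1 + δ b) ≤ W)
    (hsmall : W * (Real.exp (1 + δ') + 1) ^ 2 ≤ 1) (x : Λ) (𝒜 : Finset (Finset Λ)) (h𝒜 : ∀ A ∈ 𝒜, x ∈ A) :
    ∑ A ∈ 𝒜, ‖couplingActivity D β U μ c A‖ * Real.exp ((1 + δ') * A.card) ≤ 1 := by
  have ha : (0 : ℝ) ≤ 1 + δ' := by linarith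
  have hF : Real.exp (1 + δ') + W * (Real.exp (1 + δ') + 1) ^ 2 ≤ Real.exp (1 + δ') + 1 := by linarith
  have h := sum_norm_couplingActivity_mul_exp_le_catalan hz hr hδ hc ha hW hF x 𝒜 h𝒜
  linarith

end Smallness

end Summit.HubbardSuperconductivity.HubbardLadder.Bounds

end
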